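import Summits.QuantumFields.BalabanUV.Beta.GAN24.Lin4Additive
import Summits.QuantumFields.BalabanUV.Beta.GAN24.WSlotT2OfPieces
import Summits.QuantumFields.BalabanUV.Beta.SecondOrderRemainderTables
import Summits.QuantumFields.BalabanUV.Beta.TameKernelCalculus
import Summits.QuantumFields.BalabanUV.Gaps.CapTailPinnedLimitSign
import Literature.MathematicalPhysics.QuantumFieldTheory.Balaban1983to89.Beta.ScalewiseWitness
import Literature.MathematicalPhysics.QuantumFieldTheory.Balaban1983to89.Beta.StepDriftWitness

/-!
# `BalabanUV.Gaps.D1PinnedResponseTowers` — cell pub-balaban-gaps, row (D1), seat g1-p1: THE RESPONSE OF THE β-LEAD's PINNED FAMILY TO ITS TWO FREE SECOND-ORDER DATA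
# (border weight `cB`, position table `Tc`) AS AN EXPLICIT LINEAR TOWER — the compute targets `σ(r)` (border slope) and `λ(Tc)` (table response) of the structure theorem
# `lim β⁰ = γ(r) + φ(c⃗) + cB·σ(r) + λ(Tc)` written as limits of second moments of PURE-TADPOLE kernels of ONE linear recursion driven by gan24's `lin4 1 (KInvStep Lc j) Lc`

HONEST FRAMING (cell rule, page 1 of everything): [folklore] kernel algebra BY NAME over an2's `BalabanStepW2.T2Of ∕ WbalOf ∕ e4OfW ∕ K3OfK ∕ T2Of_loc ∕ vertexFamily₂_WbalOf'`,
`MixedJetTablesPlug.TbalOf_JsBalAn1`, gan24's `GAN24.T2RecursionAffine.vsym ∕ lin4 ∕ W2SymOfK_eq_add_vsym ∕ K3OfK_eq_sub_of_W`, `GAN24.Lin4Additive.vsym_add ∕ lin4_sub`, `GAN24.ThirdJetKernel.mmRead_sub`,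
the β sub-cell's `TameKernelCalculus.tadpole_add`, `SecondOrderRemainderTables.abs_le_of_locStencil₂`, an4's `decays_KInvStep`, `AxialDressing.decays_axDressK`, `ScalewiseWitness.secondMoment_add`,
`StepDriftWitness.absMoment₂_sub_gen`, g1-p3's `CapTailPinnedLimitSign.tendsto_pinned`.  NOTHING of Bałaban's asserted beyond print; [Balaban1987RG1] Thm 2 UNPROVED IN PRINT; which member is
print's ((P6)) NOT decided; NO coefficient computed or signed; (D1) NOT discharged; 0∕4 row-D1 binders; NOT `BetaPertH`, NOT continuum, NOT Clay.  HONEST DEPENDENCY (b2b cell, verbatim):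
«continuum YM on T⁴ ⇐ BetaPertH ∧ nine spine estimates (0/9 proved); BetaPertH ⇐ (D1) ∧ (D4) ∧ CAP+tail; G-an2-4 gates asym, D1 and NE2/3/4.»

WHY (the compute desk's recipe, kernel-exact).  For two members of the pinned family with the SAME first-order colour triple `c⃗` and second-order data `(cB, Tc)`, `(cB′, Tc′)`, the
DIFFERENCE `D_j := T2Of(c⃗; cB, Tc) j − T2Of(c⃗; cB′, Tc′) j` of an2's recursive bi-stencil families obeys ONE LINEAR RECURSION with a constant source:
`D_0 = cE₂ • (wilsonW₂ Tc − wilsonW₂ Tc′) + (cB − cB′) • mfNeg ∘ B`,  `D_{j+1} = (cE₂·wV4 (j+1)) • lin4 1 (KInvStep Lc j) Lc D_j + ((cB − cB′)·wB2 (j+1)) • mfNeg ∘ B`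
(`T2Of_dataDiff_zero ∕ _succ`: the first-order data and the `T₂`-free part of the carrier cancel; `K3OfK_eq_sub_of_W`, `vsym` additive); it is FREE of `c⃗` (`T2Of_dataDiff_universal`).  The step kernels
differ by a PURE TADPOLE: `TbalOf(cB,Tc) j − TbalOf(cB′,Tc′) j = ½·tadpole (axDressK Lc (KInvStep Lc j)) (vsym (KInvStep Lc j) Lc D_j (μ,0;ν,z))` (`TbalOf_JsBalAn1_dataDiff` — the bubble does not see the
second-order data), so do the (1.22) coefficients (`secondMoment_JsBalAn1_dataDiff`), and at the pin the limit difference IS the limit of these pure-tadpole second moments (`tendsto_dataDiff`,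
`lim_dataDiff_eq`).  READINGS: `σ(r) = lim β⁰(r,c⃗;1,Tc) − lim β⁰(r,c⃗;0,Tc)` is the limit second moment of the BORDER TOWER (`Tc = Tc′`: source `mfNeg ∘ B`, zero initial Wilson part), `λ(Tc)` that of the
TABLE TOWER (`cB = cB′`: no source, initial value `cE₂ • (wilsonW₂ Tc − wilsonW₂ Tc′)`, i.e. `cE₂ • wilsonW₂ Tc` against `Tc′ = 0` by an3's `wilsonW₂_smul`) — targets T1∕T2 of `HOME/g1/D1-PINNED-COMPUTE-TARGETS-g1p1.md`.
CONTENT (all [folklore]; no `def`, no `def … : Prop`, 0 sorry): §1 `vsym_sub`, `hessKer_sub_W`, private `abs_le₂`, private `JsBal0Of_S_indep'`; §2 `e4OfW_WbalOf_sub` (the value-4-jet read-outs of two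
assembled members differ by `lin4 1 K_j Lc (T¹_j − T⁰_j)`), **`T2Of_dataDiff_zero`**, **`T2Of_dataDiff_succ`**, **`T2Of_dataDiff_universal`** (free of the colour triple), **`T2Of_border_affine`** (the border tower is `cB •` the unit one: an2's `T2Of` is AFFINE in `cB` — GEN 9's `D1PinnedBorderWeightAffine` re-derived on built imports), `WbalOf_T2Of_dataDiff`;
§3 **`TbalOf_JsBalAn1_dataDiff`**, **`secondMoment_JsBalAn1_dataDiff`**; §4 (pin `cE₂ := Lc^8`, `2 ≤ Lc`, hypothesis-free) **`tendsto_dataDiff`**, **`lim_dataDiff_eq`**, `borderSlope_eq_lim_tower`,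
`tableResponse_eq_lim_tower`, **`lim_border_affine`** (`lim β⁰(cB,Tc) − lim β⁰(0,Tc) = cB·(lim β⁰(1,Tc) − lim β⁰(0,Tc))`, hypothesis-free, built imports).

Provenance: cell pub-balaban-gaps, seat g1-p1 GEN 12 (prover-pub-balaban-gaps-g1-p1-g12-0), 2026-08-24; imports built modules only (the same as GEN 10's `Gaps/D1PinnedSecondOrderModular` +
`Beta.StepDriftWitness`); independent of the unbuilt `Gaps/D1Pinned{Numeral,LimitClosedForm,BorderWeightAffine,FirstOrderBilinear,ColourRay*}`; no existing file touched.
-/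

noncomputable section

open Literature.MathematicalPhysics.QuantumFieldTheory Balaban1983to89 Balaban1983to89.Beta Filter Topology
open ExpKernelCalculus (MKer Decays BiLoc VertexFamily₂ comp hessKer tadpole)
open OneStepResolventKernel (Fib decays_mono biLoc_mono)
open OneStepKernelFamily (KInvStep decays_KInvStep TbalOf hTA_TbalOf)
open DecimatedMomentSummable (AbsMoment₂)
open SecondOrderResponse (W2SymOfK LocStencilFM)
open BalabanCompositeJets (LocStencil₂)
open BalabanStepJetsSucc (mmRead JsBal0Of)
open BalabanStepW2 (Spure M1 M2Of WbalOf T2Of T2Of_zero T2Of_succ T2Of_loc e4OfW K3OfK wV4 wB2 vertexFamily₂_WbalOf' WbalT2Of CwOf δwOf δwOf_pos WbalOf_loc₂)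
open WilsonBiStencil (wilsonW₂)
open StepJetData (mfNeg)
open Summit.QuantumFields.BalabanUV.Beta.GAN24.ThirdJetKernel (mmRead_sub)
open Summit.QuantumFields.BalabanUV.Beta.GAN24.T2RecursionAffine (vsym lin4 lin4_apply W2SymOfK_eq_add_vsym K3OfK_eq_sub_of_W)
open Summit.QuantumFields.BalabanUV.Beta.GAN24.Lin4Additive (vsym_add lin4_sub vsym_smul lin4_smul)
open Summit.QuantumFields.BalabanUV.Beta.SecondOrderRemainderTables (abs_le_of_locStencil₂)
open AffineAveraging (box toSite)
open AveragingMixedJetTables (vh₂SAt mixFFAt)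
open RateCertificate (CauchyRate)
open AxialDressing (axDressK axVertexOfK decays_axDressK)
open ScalewiseWitness (secondMoment_add secondMoment_smul)
open KernelReflection (tadpole_smul)
open StepDriftWitness (absMoment₂_sub_gen)
open Summit.QuantumFields.BalabanUV.Beta.TameKernelCalculus (Spr Loc tadpole_add)
open Summit.QuantumFields.BalabanUV.Beta.MixedJetTablesPlug (JsBalAn1 TbalOf_JsBalAn1 hB_an1 hmix_an1)
open Summit.QuantumFields.BalabanUV.Beta.GAN24.StencilSlotOfE3 (one_le_of_two_le)
open Summit.QuantumFields.BalabanUV.Gaps.CapTailPinnedLimitSign (tendsto_pinned)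

namespace Summit.QuantumFields.BalabanUV.Gaps.D1PinnedResponseTowers

variable {d : ℕ} {Lc : ℕ} [NeZero Lc]

/-! ## §1 Letters: `vsym` is subtractive on bounded tables; `hessKer` differences in the W-slot are pure tadpoles -/

omit [NeZero Lc] in
/-- [folklore] gan24's symmetrised bi-vertex is SUBTRACTIVE on bounded tables (decaying `K`; from `Lin4Additive.vsym_add`). -/
theorem vsym_sub {K : MKer (d + 1) (Fib d)} {C δ : ℝ} (hK : Decays K C δ) (hδ : 0 < δ) (N : ℕ)
    {T T' : Fin (d + 1) → (Fin (d + 1) → ℤ) → Fin (d + 1) → (Fin (d + 1) → ℤ) → MKer (d + 1) (Fib d)} {B : ℝ}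
    (hT : ∀ κ u κ' u' x z a b, |T κ u κ' u' x z a b| ≤ B) (hT' : ∀ κ u κ' u' x z a b, |T' κ u κ' u' x z a b| ≤ B)
    (μ : Fin (d + 1)) (y : Fin (d + 1) → ℤ) (ν : Fin (d + 1)) (y' : Fin (d + 1) → ℤ) :
    vsym K N (T - T') μ y ν y' = vsym K N T μ y ν y' - vsym K N T' μ y ν y' := by
  have hd : ∀ κ u κ' u' x z a b, |(T - T') κ u κ' u' x z a b| ≤ B + B := fun κ u κ' u' x z a b => by
    simp only [Pi.sub_apply]
    exact (abs_sub _ _).trans (add_le_add (hT κ u κ' u' x z a b) (hT' κ u κ' u' x z a b))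
  have hT'2 : ∀ κ u κ' u' x z a b, |T' κ u κ' u' x z a b| ≤ B + B := fun κ u κ' u' x z a b =>
    (hT' κ u κ' u' x z a b).trans (by linarith [(abs_nonneg _).trans (hT κ u κ' u' x z a b)])
  have h := vsym_add hK hδ N hd hT'2 μ y ν y'
  rw [sub_add_cancel] at h
  rw [h, add_sub_cancel_right]

section Kernel

variable {D : ℕ} {F : Type*} [Fintype F]

/-- [folklore] **A `hessKer` DIFFERENCE IN THE W-SLOT IS A PURE TADPOLE** (spread leg `A`, the two bond-pair members localised): the bubble does not see `W`, the tadpole is additive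
(`TameKernelCalculus.tadpole_add`): `hessKer A V W₁ b − hessKer A V W₂ b = ½·tadpole A (W₁ b₀ b − W₂ b₀ b)`. -/
theorem hessKer_sub_W {A : MKer D F} (hA : Spr A) (V : Fin D → (Fin D → ℤ) → MKer D F) {W₁ W₂ : Fin D → (Fin D → ℤ) → Fin D → (Fin D → ℤ) → MKer D F}
    (μ ν : Fin D) (z : Fin D → ℤ) (h₁ : Loc (W₁ μ 0 ν z)) (h₂ : Loc (W₂ μ 0 ν z)) :
    hessKer A V W₁ μ ν z - hessKer A V W₂ μ ν z = (1 / 2) * tadpole A (W₁ μ 0 ν z - W₂ μ 0 ν z) := by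
  have ht : tadpole A (W₁ μ 0 ν z - W₂ μ 0 ν z) + tadpole A (W₂ μ 0 ν z) = tadpole A (W₁ μ 0 ν z) := by
    rw [← tadpole_add hA (h₁.sub h₂) h₂, sub_add_cancel]
  simp only [ExpKernelCalculus.hessKer]
  linear_combination (-(1 / 2 : ℝ)) * ht

end Kernel

omit [NeZero Lc] in
/-- [folklore] Entrywise bound of a `LocStencil₂` table by a larger constant. -/
private theorem abs_le₂ {S₂ : Fin (d + 1) → (Fin (d + 1) → ℤ) → Fin (d + 1) → (Fin (d + 1) → ℤ) → MKer (d + 1) (Fib d)} {C δ : ℝ} (h : LocStencil₂ S₂ C δ) (hδ : 0 ≤ δ)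
    {B : ℝ} (hB : C ≤ B) (κ : Fin (d + 1)) (u : Fin (d + 1) → ℤ) (κ' : Fin (d + 1)) (u' x z : Fin (d + 1) → ℤ) (a b : Fib d) : |S₂ κ u κ' u' x z a b| ≤ B :=
  (abs_le_of_locStencil₂ h hδ κ u κ' u' x z a b).trans hB

/-! ## §2 THE RESPONSE TOWER: the difference of two members of an2's recursive bi-stencil family with the same colour triple obeys ONE linear recursion -/

/-- [folklore] **THE VALUE-4-JET READ-OUTS OF TWO ASSEMBLED SECOND-ORDER MEMBERS DIFFER BY `lin4 1 K_j Lc (T¹_j − T⁰_j)`** (same first-order data, certified tables; every level, every bond pair):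
`e4OfW j S_j M_j (WbalOf … T¹ … j) b − e4OfW j S_j M_j (WbalOf … T⁰ … j) b = lin4 1 (KInvStep Lc j) Lc (T¹ j − T⁰ j) b` — `mmRead_sub`, gan24's `K3OfK_eq_sub_of_W` at the common bond-pair
localisation (`vertexFamily₂_WbalOf'`, rates matched by `biLoc_mono`), `W2SymOfK_eq_add_vsym`, `vsym_sub` on the bounded members (`T2Of`-type certificates), `lin4_apply`. -/
theorem e4OfW_WbalOf_sub (hLc : 1 ≤ Lc) (cE cVH cΛ : ℝ)
    {T₁ T₀ : ℕ → Fin (d + 1) → (Fin (d + 1) → ℤ) → Fin (d + 1) → (Fin (d + 1) → ℤ) → MKer (d + 1) (Fib d)}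
    (hT₁ : ∀ j, ∃ C δ : ℝ, 0 < δ ∧ LocStencil₂ (T₁ j) C δ) (hT₀ : ∀ j, ∃ C δ : ℝ, 0 < δ ∧ LocStencil₂ (T₀ j) C δ)
    {mixFF : Fin (d + 1) → (Fin (d + 1) → ℤ) → Fin (d + 1) → (Fin (d + 1) → ℤ) → MKer (d + 1) (Fib d)} (hmix : ∃ C δ : ℝ, 0 < δ ∧ LocStencilFM Lc mixFF C δ) (j : ℕ)
    (κ : Fin (d + 1)) (u : Fin (d + 1) → ℤ) (κ' : Fin (d + 1)) (u' : Fin (d + 1) → ℤ) :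
    e4OfW d Lc j (Spure d Lc cE cVH cΛ j) (M1 d Lc cΛ j) (WbalOf d Lc cE cVH cΛ T₁ mixFF j) κ u κ' u' -
        e4OfW d Lc j (Spure d Lc cE cVH cΛ j) (M1 d Lc cΛ j) (WbalOf d Lc cE cVH cΛ T₀ mixFF j) κ u κ' u' =
      lin4 1 (KInvStep (d := d) Lc j) Lc (T₁ j - T₀ j) κ u κ' u' := by
  obtain ⟨δK, CK, hδK, hCK, hK⟩ := decays_KInvStep (Lc := Lc) (d := d) j
  obtain ⟨Cw₁, δw₁, hδw₁, hW₁⟩ := vertexFamily₂_WbalOf' (d := d) hLc cE cVH cΛ hT₁ hmix j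
  obtain ⟨Cw₀, δw₀, hδw₀, hW₀⟩ := vertexFamily₂_WbalOf' (d := d) hLc cE cVH cΛ hT₀ hmix j
  set m : ℝ := min δK (min δw₁ δw₀) with hm
  have hm0 : 0 < m := lt_min hδK (lt_min hδw₁ hδw₀)
  have hKm : Decays (KInvStep (d := d) Lc j) CK m := decays_mono hK hCK le_rfl (min_le_left _ _)
  have hCw₁ : 0 ≤ Cw₁ := (hW₁ 0 0 0 0).nonneg (Sum.inl 0)
  have hCw₀ : 0 ≤ Cw₀ := (hW₀ 0 0 0 0).nonneg (Sum.inl 0)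
  have hb₁ : BiLoc (WbalOf d Lc cE cVH cΛ T₁ mixFF j κ u κ' u') ((Lc : ℤ) • u) ((Lc : ℤ) • u') Cw₁ m :=
    biLoc_mono (hW₁ κ u κ' u') hCw₁ ((min_le_right _ _).trans (min_le_left _ _))
  have hb₀ : BiLoc (WbalOf d Lc cE cVH cΛ T₀ mixFF j κ u κ' u') ((Lc : ℤ) • u) ((Lc : ℤ) • u') Cw₀ m :=
    biLoc_mono (hW₀ κ u κ' u') hCw₀ ((min_le_right _ _).trans (min_le_right _ _))
  -- the two assembled members differ by `vsym` of the difference of their bi-stencil slots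
  obtain ⟨C₁, δ₁, hδ₁, hL₁⟩ := hT₁ j
  obtain ⟨C₀, δ₀, hδ₀, hL₀⟩ := hT₀ j
  have hC₁ : 0 ≤ C₁ := (abs_nonneg _).trans (abs_le_of_locStencil₂ hL₁ hδ₁.le 0 0 0 0 0 0 (Sum.inl 0) (Sum.inl 0))
  have hC₀ : 0 ≤ C₀ := (abs_nonneg _).trans (abs_le_of_locStencil₂ hL₀ hδ₀.le 0 0 0 0 0 0 (Sum.inl 0) (Sum.inl 0))
  have bd₁ : ∀ κ u κ' u' x z a b, |T₁ j κ u κ' u' x z a b| ≤ C₁ + C₀ := fun κ u κ' u' x z a b => abs_le₂ hL₁ hδ₁.le (by linarith) κ u κ' u' x z a b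
  have bd₀ : ∀ κ u κ' u' x z a b, |T₀ j κ u κ' u' x z a b| ≤ C₁ + C₀ := fun κ u κ' u' x z a b => abs_le₂ hL₀ hδ₀.le (by linarith) κ u κ' u' x z a b
  have hdiff : WbalOf d Lc cE cVH cΛ T₁ mixFF j κ u κ' u' - WbalOf d Lc cE cVH cΛ T₀ mixFF j κ u κ' u' = vsym (KInvStep (d := d) Lc j) Lc (T₁ j - T₀ j) κ u κ' u' := by
    have e₁ := congrArg (fun F => F κ u κ' u') (W2SymOfK_eq_add_vsym (KInvStep (d := d) Lc j) Lc (Spure d Lc cE cVH cΛ j) (M1 d Lc cΛ j) (T₁ j) (M2Of d Lc mixFF j))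
    have e₀ := congrArg (fun F => F κ u κ' u') (W2SymOfK_eq_add_vsym (KInvStep (d := d) Lc j) Lc (Spure d Lc cE cVH cΛ j) (M1 d Lc cΛ j) (T₀ j) (M2Of d Lc mixFF j))
    simp only [Pi.add_apply] at e₁ e₀
    unfold BalabanStepW2.WbalOf
    rw [e₁, e₀, vsym_sub hK hδK Lc bd₁ bd₀ κ u κ' u']
    abel
  unfold BalabanStepW2.e4OfW
  rw [K3OfK_eq_sub_of_W hKm hm0 Lc _ _ hb₁ hb₀, hdiff, mmRead_sub, lin4_apply, one_smul, sub_sub_cancel_left]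

section Tower

variable (cE cVH cΛ cE₂ cB cB' : ℝ) (T T' : Fin 4 → Fin 4 → Fin 4 → Fin 4 → ℝ)
  {B : Fin (d + 1) → (Fin (d + 1) → ℤ) → Fin (d + 1) → (Fin (d + 1) → ℤ) → MKer (d + 1) (Fib d)}
  {mixFF : Fin (d + 1) → (Fin (d + 1) → ℤ) → Fin (d + 1) → (Fin (d + 1) → ℤ) → MKer (d + 1) (Fib d)}

/-- [folklore] **THE RESPONSE TOWER, MEMBER 0**: `T2Of(c⃗; cB, T) 0 − T2Of(c⃗; cB′, T′) 0 = cE₂ • (wilsonW₂ T − wilsonW₂ T′) + (cB − cB′) • mfNeg ∘ B` (`T2Of_zero`; no property of an3's table used). -/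
theorem T2Of_dataDiff_zero (κ : Fin (d + 1)) (u : Fin (d + 1) → ℤ) (κ' : Fin (d + 1)) (u' : Fin (d + 1) → ℤ) :
    T2Of d Lc cE cVH cΛ cE₂ cB T B mixFF 0 κ u κ' u' - T2Of d Lc cE cVH cΛ cE₂ cB' T' B mixFF 0 κ u κ' u' =
      cE₂ • (wilsonW₂ d T κ u κ' u' - wilsonW₂ d T' κ u κ' u') + (cB - cB') • mfNeg (B κ u κ' u') := by
  simp only [T2Of_zero]
  funext x z a b
  simp only [Pi.add_apply, Pi.sub_apply, Pi.smul_apply, smul_eq_mul]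
  ring

/-- [folklore] **THE RESPONSE TOWER, STEP `j → j+1`** (`1 ≤ Lc`, certified border ∕ mixed tables, any colour triple, any `cE₂`): with `D_j := T2Of(c⃗; cB, T) j − T2Of(c⃗; cB′, T′) j`,
`D_{j+1} b = (cE₂·wV4 (j+1)) • lin4 1 (KInvStep Lc j) Lc D_j b + ((cB − cB′)·wB2 (j+1)) • mfNeg (B b)` — the first-order data and the `T₂`-free part of the carrier CANCEL (`e4OfW_WbalOf_sub`). -/
theorem T2Of_dataDiff_succ (hLc : 1 ≤ Lc) (hB : ∃ C δ : ℝ, 0 < δ ∧ LocStencil₂ B C δ) (hmix : ∃ C δ : ℝ, 0 < δ ∧ LocStencilFM Lc mixFF C δ) (j : ℕ)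
    (κ : Fin (d + 1)) (u : Fin (d + 1) → ℤ) (κ' : Fin (d + 1)) (u' : Fin (d + 1) → ℤ) :
    T2Of d Lc cE cVH cΛ cE₂ cB T B mixFF (j + 1) κ u κ' u' - T2Of d Lc cE cVH cΛ cE₂ cB' T' B mixFF (j + 1) κ u κ' u' =
      (cE₂ * wV4 d Lc (j + 1)) • lin4 1 (KInvStep (d := d) Lc j) Lc (T2Of d Lc cE cVH cΛ cE₂ cB T B mixFF j - T2Of d Lc cE cVH cΛ cE₂ cB' T' B mixFF j) κ u κ' u' +
        ((cB - cB') * wB2 d Lc (j + 1)) • mfNeg (B κ u κ' u') := by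
  rw [← e4OfW_WbalOf_sub hLc cE cVH cΛ (T2Of_loc (d := d) hLc cE cVH cΛ cE₂ cB T hB hmix) (T2Of_loc (d := d) hLc cE cVH cΛ cE₂ cB' T' hB hmix) hmix j κ u κ' u']
  simp only [T2Of_succ]
  funext x z a b
  simp only [Pi.add_apply, Pi.sub_apply, Pi.smul_apply, smul_eq_mul]
  ring

/-- [folklore] **THE RESPONSE TOWER IS FREE OF THE FIRST-ORDER COLOUR TRIPLE** (same recursion, same initial value): for two colour triples `c⃗, c⃗′` and every level,
`T2Of(c⃗; cB, T) j − T2Of(c⃗; cB′, T′) j = T2Of(c⃗′; cB, T) j − T2Of(c⃗′; cB′, T′) j` — GEN 10's universality of the `(cB,Tc)`-response, re-derived as the uniqueness of the tower's solution. -/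
theorem T2Of_dataDiff_universal (hLc : 1 ≤ Lc) (cE' cVH' cΛ' : ℝ) (hB : ∃ C δ : ℝ, 0 < δ ∧ LocStencil₂ B C δ) (hmix : ∃ C δ : ℝ, 0 < δ ∧ LocStencilFM Lc mixFF C δ) :
    ∀ j : ℕ, T2Of d Lc cE cVH cΛ cE₂ cB T B mixFF j - T2Of d Lc cE cVH cΛ cE₂ cB' T' B mixFF j =
      T2Of d Lc cE' cVH' cΛ' cE₂ cB T B mixFF j - T2Of d Lc cE' cVH' cΛ' cE₂ cB' T' B mixFF j
  | 0 => by
    funext κ u κ' u'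
    simp only [Pi.sub_apply]
    rw [T2Of_dataDiff_zero, T2Of_dataDiff_zero]
  | j + 1 => by
    have IH := T2Of_dataDiff_universal hLc cE' cVH' cΛ' hB hmix j
    funext κ u κ' u'
    simp only [Pi.sub_apply]
    rw [T2Of_dataDiff_succ cE cVH cΛ cE₂ cB cB' T T' hLc hB hmix j, T2Of_dataDiff_succ cE' cVH' cΛ' cE₂ cB cB' T T' hLc hB hmix j, IH]

/-- [folklore] **THE BORDER TOWER IS HOMOGENEOUS IN THE BORDER WEIGHT — an2's `T2Of` IS AFFINE IN `cB`** (same recursion, `lin4_smul`; every level):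
`T2Of(c⃗; cB, T) j − T2Of(c⃗; 0, T) j = cB • (T2Of(c⃗; 1, T) j − T2Of(c⃗; 0, T) j)` — GEN 9's cB-affinity (`Gaps/D1PinnedBorderWeightAffine`, no farm olean at the time of writing) RE-DERIVED from the tower
on built imports. -/
theorem T2Of_border_affine (hLc : 1 ≤ Lc) (hB : ∃ C δ : ℝ, 0 < δ ∧ LocStencil₂ B C δ) (hmix : ∃ C δ : ℝ, 0 < δ ∧ LocStencilFM Lc mixFF C δ) :
    ∀ j : ℕ, T2Of d Lc cE cVH cΛ cE₂ cB T B mixFF j - T2Of d Lc cE cVH cΛ cE₂ 0 T B mixFF j =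
      cB • (T2Of d Lc cE cVH cΛ cE₂ 1 T B mixFF j - T2Of d Lc cE cVH cΛ cE₂ 0 T B mixFF j)
  | 0 => by
    funext κ u κ' u'
    simp only [Pi.sub_apply, Pi.smul_apply]
    rw [T2Of_dataDiff_zero, T2Of_dataDiff_zero]
    funext x z a b
    simp only [Pi.add_apply, Pi.sub_apply, Pi.smul_apply, smul_eq_mul]
    ring
  | j + 1 => by
    have IH := T2Of_border_affine hLc hB hmix j
    funext κ u κ' u'
    simp only [Pi.sub_apply, Pi.smul_apply]
    rw [T2Of_dataDiff_succ cE cVH cΛ cE₂ cB 0 T T hLc hB hmix j, T2Of_dataDiff_succ cE cVH cΛ cE₂ 1 0 T T hLc hB hmix j, IH, lin4_smul]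
    funext x z a b
    simp only [Pi.add_apply, Pi.smul_apply, smul_eq_mul]
    ring

/-- [folklore] **THE ASSEMBLED SECOND-ORDER MEMBERS DIFFER BY `vsym` OF THE TOWER** (same colour triple; every level, every bond pair):
`WbalOf(c⃗)(T2Of(c⃗;cB,T)) j b − WbalOf(c⃗)(T2Of(c⃗;cB′,T′)) j b = vsym (KInvStep Lc j) Lc D_j b`. -/
theorem WbalOf_T2Of_dataDiff (hLc : 1 ≤ Lc) (hB : ∃ C δ : ℝ, 0 < δ ∧ LocStencil₂ B C δ) (hmix : ∃ C δ : ℝ, 0 < δ ∧ LocStencilFM Lc mixFF C δ) (j : ℕ)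
    (κ : Fin (d + 1)) (u : Fin (d + 1) → ℤ) (κ' : Fin (d + 1)) (u' : Fin (d + 1) → ℤ) :
    WbalOf d Lc cE cVH cΛ (T2Of d Lc cE cVH cΛ cE₂ cB T B mixFF) mixFF j κ u κ' u' - WbalOf d Lc cE cVH cΛ (T2Of d Lc cE cVH cΛ cE₂ cB' T' B mixFF) mixFF j κ u κ' u' =
      vsym (KInvStep (d := d) Lc j) Lc (T2Of d Lc cE cVH cΛ cE₂ cB T B mixFF j - T2Of d Lc cE cVH cΛ cE₂ cB' T' B mixFF j) κ u κ' u' := by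
  obtain ⟨δK, CK, hδK, -, hK⟩ := decays_KInvStep (Lc := Lc) (d := d) j
  obtain ⟨C₁, δ₁, hδ₁, hL₁⟩ := T2Of_loc (d := d) hLc cE cVH cΛ cE₂ cB T hB hmix j
  obtain ⟨C₀, δ₀, hδ₀, hL₀⟩ := T2Of_loc (d := d) hLc cE cVH cΛ cE₂ cB' T' hB hmix j
  have hC₁ : 0 ≤ C₁ := (abs_nonneg _).trans (abs_le_of_locStencil₂ hL₁ hδ₁.le 0 0 0 0 0 0 (Sum.inl 0) (Sum.inl 0))
  have hC₀ : 0 ≤ C₀ := (abs_nonneg _).trans (abs_le_of_locStencil₂ hL₀ hδ₀.le 0 0 0 0 0 0 (Sum.inl 0) (Sum.inl 0))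
  have bd₁ : ∀ κ u κ' u' x z a b, |T2Of d Lc cE cVH cΛ cE₂ cB T B mixFF j κ u κ' u' x z a b| ≤ C₁ + C₀ :=
    fun κ u κ' u' x z a b => abs_le₂ hL₁ hδ₁.le (by linarith) κ u κ' u' x z a b
  have bd₀ : ∀ κ u κ' u' x z a b, |T2Of d Lc cE cVH cΛ cE₂ cB' T' B mixFF j κ u κ' u' x z a b| ≤ C₁ + C₀ :=
    fun κ u κ' u' x z a b => abs_le₂ hL₀ hδ₀.le (by linarith) κ u κ' u' x z a b
  have e₁ := congrArg (fun F => F κ u κ' u') (W2SymOfK_eq_add_vsym (KInvStep (d := d) Lc j) Lc (Spure d Lc cE cVH cΛ j) (M1 d Lc cΛ j)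
    (T2Of d Lc cE cVH cΛ cE₂ cB T B mixFF j) (M2Of d Lc mixFF j))
  have e₀ := congrArg (fun F => F κ u κ' u') (W2SymOfK_eq_add_vsym (KInvStep (d := d) Lc j) Lc (Spure d Lc cE cVH cΛ j) (M1 d Lc cΛ j)
    (T2Of d Lc cE cVH cΛ cE₂ cB' T' B mixFF j) (M2Of d Lc mixFF j))
  simp only [Pi.add_apply] at e₁ e₀
  unfold BalabanStepW2.WbalOf
  rw [e₁, e₀, vsym_sub hK hδK Lc bd₁ bd₀ κ u κ' u']
  abel

end Tower

/-! ## §3 The pinned family: the step kernels and (1.22) coefficients of two members with the same colour triple differ by the PURE TADPOLE of the tower -/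

section Pinned

variable {r : Fin (3 + 1) → ℕ}

/-- [folklore] The first-order part of an2's jet datum does not depend on the second-order tables or their certificates (PRIVATE twin of GEN 9's `D1PinnedBorderWeightAffine.JsBal0Of_S_indep`,
whose module has no farm olean at the time of writing; `rfl` by cases). -/
private theorem JsBal0Of_S_indep' (hLc : 1 ≤ Lc) (cE cVH cΛ : ℝ)
    (W W' : ℕ → Fin (3 + 1) → (Fin (3 + 1) → ℤ) → Fin (3 + 1) → (Fin (3 + 1) → ℤ) → MKer (3 + 1) (Fib 3))
    (Cw δw : ℕ → ℝ) (hδw : ∀ j, 0 < δw j) (hW : ∀ j, VertexFamily₂ (W j) Lc (Cw j) (δw j))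
    (Cw' δw' : ℕ → ℝ) (hδw' : ∀ j, 0 < δw' j) (hW' : ∀ j, VertexFamily₂ (W' j) Lc (Cw' j) (δw' j)) :
    ∀ j : ℕ, (JsBal0Of hLc cE cVH cΛ W Cw δw hδw hW j).S = (JsBal0Of hLc cE cVH cΛ W' Cw' δw' hδw' hW' j).S
  | 0 => rfl
  | _ + 1 => rfl

/-- [folklore] **THE PINNED FAMILY's STEP KERNELS OF TWO MEMBERS WITH THE SAME COLOUR TRIPLE DIFFER BY THE PURE TADPOLE OF THE TOWER** (`1 ≤ Lc`; any `cE₂`; any box root; every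
level, every entry): `TbalOf (JsBalAn1 r c⃗ cE₂ cB Tc) j μ ν z − TbalOf (JsBalAn1 r c⃗ cE₂ cB′ Tc′) j μ ν z = ½ · tadpole (axDressK Lc (KInvStep Lc j)) (vsym (KInvStep Lc j) Lc D_j (μ,0;ν,z))`,
`D_j` the response tower of §2 at an1's tables of root `r` — `TbalOf_JsBalAn1` (closed `Π`-form; the bubble legs depend on `c⃗` only), `hessKer_sub_W`, `WbalOf_T2Of_dataDiff`. -/
theorem TbalOf_JsBalAn1_dataDiff (hLc : 1 ≤ Lc) (hr : r ∈ box (3 + 1) Lc) (cE cVH cΛ cE₂ cB cB' : ℝ) (T T' : Fin 4 → Fin 4 → Fin 4 → Fin 4 → ℝ) (j : ℕ)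
    (μ ν : Fin 4) (z : Fin 4 → ℤ) :
    TbalOf Lc (JsBalAn1 hLc hr cE cVH cΛ cE₂ cB T) j μ ν z - TbalOf Lc (JsBalAn1 hLc hr cE cVH cΛ cE₂ cB' T') j μ ν z =
      (1 / 2) * tadpole (axDressK Lc (KInvStep (d := 3) Lc j)) (vsym (KInvStep (d := 3) Lc j) Lc
        (T2Of 3 Lc cE cVH cΛ cE₂ cB T (vh₂SAt (toSite r) Lc) (mixFFAt (toSite r) Lc) j - T2Of 3 Lc cE cVH cΛ cE₂ cB' T' (vh₂SAt (toSite r) Lc) (mixFFAt (toSite r) Lc) j) μ 0 ν z) := by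
  rw [TbalOf_JsBalAn1 hLc hr cE cVH cΛ cE₂ cB T j, TbalOf_JsBalAn1 hLc hr cE cVH cΛ cE₂ cB' T' j]
  -- the first-order vertex family is the same for both members (it does not see the second-order tables)
  have hV := JsBal0Of_S_indep' hLc cE cVH cΛ
    (WbalT2Of (Lc := Lc) cE cVH cΛ cE₂ cB T (vh₂S := vh₂SAt (toSite r) Lc) (mixFF := mixFFAt (toSite r) Lc))
    (WbalT2Of (Lc := Lc) cE cVH cΛ cE₂ cB' T' (vh₂S := vh₂SAt (toSite r) Lc) (mixFF := mixFFAt (toSite r) Lc))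
    (CwOf hLc cE cVH cΛ (T2Of_loc hLc cE cVH cΛ cE₂ cB T (hB_an1 hLc hr) (hmix_an1 hLc hr)) (hmix_an1 hLc hr))
    (δwOf hLc cE cVH cΛ (T2Of_loc hLc cE cVH cΛ cE₂ cB T (hB_an1 hLc hr) (hmix_an1 hLc hr)) (hmix_an1 hLc hr))
    (δwOf_pos hLc cE cVH cΛ (T2Of_loc hLc cE cVH cΛ cE₂ cB T (hB_an1 hLc hr) (hmix_an1 hLc hr)) (hmix_an1 hLc hr))
    (WbalOf_loc₂ hLc cE cVH cΛ (T2Of_loc hLc cE cVH cΛ cE₂ cB T (hB_an1 hLc hr) (hmix_an1 hLc hr)) (hmix_an1 hLc hr))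
    (CwOf hLc cE cVH cΛ (T2Of_loc hLc cE cVH cΛ cE₂ cB' T' (hB_an1 hLc hr) (hmix_an1 hLc hr)) (hmix_an1 hLc hr))
    (δwOf hLc cE cVH cΛ (T2Of_loc hLc cE cVH cΛ cE₂ cB' T' (hB_an1 hLc hr) (hmix_an1 hLc hr)) (hmix_an1 hLc hr))
    (δwOf_pos hLc cE cVH cΛ (T2Of_loc hLc cE cVH cΛ cE₂ cB' T' (hB_an1 hLc hr) (hmix_an1 hLc hr)) (hmix_an1 hLc hr))
    (WbalOf_loc₂ hLc cE cVH cΛ (T2Of_loc hLc cE cVH cΛ cE₂ cB' T' (hB_an1 hLc hr) (hmix_an1 hLc hr)) (hmix_an1 hLc hr)) j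
  rw [hV]
  obtain ⟨δK, CK, hδK, -, hK⟩ := decays_KInvStep (Lc := Lc) (d := 3) j
  have hA : Spr (axDressK Lc (KInvStep (d := 3) Lc j)) := ⟨_, δK, hδK, decays_axDressK hLc hK hδK.le⟩
  obtain ⟨Cw₁, δw₁, hδw₁, hW₁⟩ := vertexFamily₂_WbalOf' (d := 3) hLc cE cVH cΛ (T2Of_loc (d := 3) hLc cE cVH cΛ cE₂ cB T (hB_an1 hLc hr) (hmix_an1 hLc hr)) (hmix_an1 hLc hr) j
  obtain ⟨Cw₀, δw₀, hδw₀, hW₀⟩ := vertexFamily₂_WbalOf' (d := 3) hLc cE cVH cΛ (T2Of_loc (d := 3) hLc cE cVH cΛ cE₂ cB' T' (hB_an1 hLc hr) (hmix_an1 hLc hr)) (hmix_an1 hLc hr) j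
  refine (hessKer_sub_W hA _ μ ν z ⟨_, _, _, _, hδw₁, hW₁ μ 0 ν z⟩ ⟨_, _, _, _, hδw₀, hW₀ μ 0 ν z⟩).trans ?_
  rw [WbalOf_T2Of_dataDiff cE cVH cΛ cE₂ cB cB' T T' hLc (hB_an1 hLc hr) (hmix_an1 hLc hr) j μ 0 ν z]

/-- [folklore] **THE (1.22) COEFFICIENTS OF TWO MEMBERS WITH THE SAME COLOUR TRIPLE DIFFER BY THE SECOND MOMENT OF THE PURE-TADPOLE KERNEL OF THE TOWER** (every level, every channel):
`β⁰_j(r,c⃗;cB,Tc) − β⁰_j(r,c⃗;cB′,Tc′) = secondMoment (½·tadpole (Π K_j Π) (vsym K_j Lc D_j (·,0;·,·)))` (`secondMoment_add` on the difference kernel, `absMoment₂_sub_gen`, `hTA_TbalOf`). -/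
theorem secondMoment_JsBalAn1_dataDiff (hLc : 1 ≤ Lc) (hr : r ∈ box (3 + 1) Lc) (cE cVH cΛ cE₂ cB cB' : ℝ) (T T' : Fin 4 → Fin 4 → Fin 4 → Fin 4 → ℝ) (j : ℕ) (μ ν : Fin 4) :
    B12Beta.secondMoment (TbalOf Lc (JsBalAn1 hLc hr cE cVH cΛ cE₂ cB T) j) μ ν - B12Beta.secondMoment (TbalOf Lc (JsBalAn1 hLc hr cE cVH cΛ cE₂ cB' T') j) μ ν =
      B12Beta.secondMoment (fun μ ν z => (1 / 2) * tadpole (axDressK Lc (KInvStep (d := 3) Lc j)) (vsym (KInvStep (d := 3) Lc j) Lc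
        (T2Of 3 Lc cE cVH cΛ cE₂ cB T (vh₂SAt (toSite r) Lc) (mixFFAt (toSite r) Lc) j - T2Of 3 Lc cE cVH cΛ cE₂ cB' T' (vh₂SAt (toSite r) Lc) (mixFFAt (toSite r) Lc) j) μ 0 ν z)) μ ν := by
  have hF : ∀ c e, AbsMoment₂ ((fun μ ν z => TbalOf Lc (JsBalAn1 hLc hr cE cVH cΛ cE₂ cB T) j μ ν z - TbalOf Lc (JsBalAn1 hLc hr cE cVH cΛ cE₂ cB' T') j μ ν z) c e) :=
    fun c e => absMoment₂_sub_gen (hTA_TbalOf (JsBalAn1 hLc hr cE cVH cΛ cE₂ cB T) j c e) (hTA_TbalOf (JsBalAn1 hLc hr cE cVH cΛ cE₂ cB' T') j c e)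
  have hsplit : TbalOf Lc (JsBalAn1 hLc hr cE cVH cΛ cE₂ cB T) j =
      (fun μ ν z => TbalOf Lc (JsBalAn1 hLc hr cE cVH cΛ cE₂ cB T) j μ ν z - TbalOf Lc (JsBalAn1 hLc hr cE cVH cΛ cE₂ cB' T') j μ ν z) + TbalOf Lc (JsBalAn1 hLc hr cE cVH cΛ cE₂ cB' T') j := by
    funext μ' ν' z; simp only [Pi.add_apply, sub_add_cancel]
  have hker : (fun μ ν z => TbalOf Lc (JsBalAn1 hLc hr cE cVH cΛ cE₂ cB T) j μ ν z - TbalOf Lc (JsBalAn1 hLc hr cE cVH cΛ cE₂ cB' T') j μ ν z) =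
      fun μ ν z => (1 / 2) * tadpole (axDressK Lc (KInvStep (d := 3) Lc j)) (vsym (KInvStep (d := 3) Lc j) Lc
        (T2Of 3 Lc cE cVH cΛ cE₂ cB T (vh₂SAt (toSite r) Lc) (mixFFAt (toSite r) Lc) j - T2Of 3 Lc cE cVH cΛ cE₂ cB' T' (vh₂SAt (toSite r) Lc) (mixFFAt (toSite r) Lc) j) μ 0 ν z) := by
    funext μ' ν' z; exact TbalOf_JsBalAn1_dataDiff hLc hr cE cVH cΛ cE₂ cB cB' T T' j μ' ν' z
  have h := secondMoment_add hF (hTA_TbalOf (JsBalAn1 hLc hr cE cVH cΛ cE₂ cB' T') j) μ ν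
  rw [← hsplit] at h
  rw [h, add_sub_cancel_right, hker]

end Pinned

/-! ## §4 UNCONDITIONAL at the pin `cE₂ := Lc^8`, `2 ≤ Lc`: the limit response IS the limit of the tower's pure-tadpole second moments -/

section Consequences

variable {r : Fin (3 + 1) → ℕ}

/-- [folklore] **THE TOWER's PURE-TADPOLE SECOND MOMENTS CONVERGE TO THE LIMIT RESPONSE, HYPOTHESIS-FREE** (pin `cE₂ := Lc^8`, `2 ≤ Lc`; any box root, colour triple, channel; two members
with data `(cB,Tc)`, `(cB′,Tc′)`): `secondMoment (½·tadpole (Π K_j Π) (vsym K_j Lc D_j)) ⟶ lim β⁰(r,c⃗;cB,Tc) − lim β⁰(r,c⃗;cB′,Tc′)` (g1-p3's `tendsto_pinned` ×2 + §3). -/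
theorem tendsto_dataDiff (hLc : 2 ≤ Lc) (hr : r ∈ box (3 + 1) Lc) (cE cVH cΛ cB cB' : ℝ) (Tc Tc' : Fin 4 → Fin 4 → Fin 4 → Fin 4 → ℝ) (μ ν : Fin 4) :
    Tendsto (fun j => B12Beta.secondMoment (fun μ ν z => (1 / 2) * tadpole (axDressK Lc (KInvStep (d := 3) Lc j)) (vsym (KInvStep (d := 3) Lc j) Lc
        (T2Of 3 Lc cE cVH cΛ ((Lc : ℝ) ^ (2 * (3 + 1))) cB Tc (vh₂SAt (toSite r) Lc) (mixFFAt (toSite r) Lc) j -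
          T2Of 3 Lc cE cVH cΛ ((Lc : ℝ) ^ (2 * (3 + 1))) cB' Tc' (vh₂SAt (toSite r) Lc) (mixFFAt (toSite r) Lc) j) μ 0 ν z)) μ ν) atTop
      (𝓝 (CauchyRate.lim (fun j => B12Beta.secondMoment (TbalOf Lc (JsBalAn1 (one_le_of_two_le hLc) hr cE cVH cΛ ((Lc : ℝ) ^ (2 * (3 + 1))) cB Tc) j) μ ν) -
        CauchyRate.lim (fun j => B12Beta.secondMoment (TbalOf Lc (JsBalAn1 (one_le_of_two_le hLc) hr cE cVH cΛ ((Lc : ℝ) ^ (2 * (3 + 1))) cB' Tc') j) μ ν))) :=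
  ((tendsto_pinned hLc hr cE cVH cΛ cB Tc μ ν).sub (tendsto_pinned hLc hr cE cVH cΛ cB' Tc' μ ν)).congr fun j =>
    secondMoment_JsBalAn1_dataDiff (one_le_of_two_le hLc) hr cE cVH cΛ _ cB cB' Tc Tc' j μ ν

/-- [folklore] **THE LIMIT RESPONSE AS THE CONSTRUCTED LIMIT OF THE TOWER's SECOND MOMENTS, HYPOTHESIS-FREE**:
`lim β⁰(r,c⃗;cB,Tc) − lim β⁰(r,c⃗;cB′,Tc′) = CauchyRate.lim (j ↦ secondMoment (½·tadpole (Π K_j Π) (vsym K_j Lc D_j)))` (`Tendsto.limUnder_eq`). -/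
theorem lim_dataDiff_eq (hLc : 2 ≤ Lc) (hr : r ∈ box (3 + 1) Lc) (cE cVH cΛ cB cB' : ℝ) (Tc Tc' : Fin 4 → Fin 4 → Fin 4 → Fin 4 → ℝ) (μ ν : Fin 4) :
    CauchyRate.lim (fun j => B12Beta.secondMoment (TbalOf Lc (JsBalAn1 (one_le_of_two_le hLc) hr cE cVH cΛ ((Lc : ℝ) ^ (2 * (3 + 1))) cB Tc) j) μ ν) -
        CauchyRate.lim (fun j => B12Beta.secondMoment (TbalOf Lc (JsBalAn1 (one_le_of_two_le hLc) hr cE cVH cΛ ((Lc : ℝ) ^ (2 * (3 + 1))) cB' Tc') j) μ ν) =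
      CauchyRate.lim (fun j => B12Beta.secondMoment (fun μ ν z => (1 / 2) * tadpole (axDressK Lc (KInvStep (d := 3) Lc j)) (vsym (KInvStep (d := 3) Lc j) Lc
        (T2Of 3 Lc cE cVH cΛ ((Lc : ℝ) ^ (2 * (3 + 1))) cB Tc (vh₂SAt (toSite r) Lc) (mixFFAt (toSite r) Lc) j -
          T2Of 3 Lc cE cVH cΛ ((Lc : ℝ) ^ (2 * (3 + 1))) cB' Tc' (vh₂SAt (toSite r) Lc) (mixFFAt (toSite r) Lc) j) μ 0 ν z)) μ ν) :=
  ((tendsto_dataDiff hLc hr cE cVH cΛ cB cB' Tc Tc' μ ν).limUnder_eq).symm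

/-- [folklore] **READING — THE BORDER SLOPE `σ(r)` IS THE LIMIT SECOND MOMENT OF THE BORDER TOWER** (`Tc′ = Tc`, `cB′ = 0`, `cB = 1`; hypothesis-free): the tower of §2 then has initial value
`mfNeg ∘ B` (the Wilson parts cancel, `T2Of_dataDiff_zero`) and source `wB2 (j+1) • mfNeg ∘ B` (`T2Of_dataDiff_succ`), free of `c⃗` and `Tc` (`T2Of_dataDiff_universal`);
`σ(r) := lim β⁰(r,c⃗;1,Tc) − lim β⁰(r,c⃗;0,Tc)` is the constructed limit of its pure-tadpole second moments. -/
theorem borderSlope_eq_lim_tower (hLc : 2 ≤ Lc) (hr : r ∈ box (3 + 1) Lc) (cE cVH cΛ : ℝ) (Tc : Fin 4 → Fin 4 → Fin 4 → Fin 4 → ℝ) (μ ν : Fin 4) :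
    CauchyRate.lim (fun j => B12Beta.secondMoment (TbalOf Lc (JsBalAn1 (one_le_of_two_le hLc) hr cE cVH cΛ ((Lc : ℝ) ^ (2 * (3 + 1))) 1 Tc) j) μ ν) -
        CauchyRate.lim (fun j => B12Beta.secondMoment (TbalOf Lc (JsBalAn1 (one_le_of_two_le hLc) hr cE cVH cΛ ((Lc : ℝ) ^ (2 * (3 + 1))) 0 Tc) j) μ ν) =
      CauchyRate.lim (fun j => B12Beta.secondMoment (fun μ ν z => (1 / 2) * tadpole (axDressK Lc (KInvStep (d := 3) Lc j)) (vsym (KInvStep (d := 3) Lc j) Lc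
        (T2Of 3 Lc cE cVH cΛ ((Lc : ℝ) ^ (2 * (3 + 1))) 1 Tc (vh₂SAt (toSite r) Lc) (mixFFAt (toSite r) Lc) j -
          T2Of 3 Lc cE cVH cΛ ((Lc : ℝ) ^ (2 * (3 + 1))) 0 Tc (vh₂SAt (toSite r) Lc) (mixFFAt (toSite r) Lc) j) μ 0 ν z)) μ ν) :=
  lim_dataDiff_eq hLc hr cE cVH cΛ 1 0 Tc Tc μ ν

/-- [folklore] **READING — THE TABLE RESPONSE `λ` IS THE LIMIT SECOND MOMENT OF THE TABLE TOWER** (`cB′ = cB`, `Tc′ = 0`; hypothesis-free): the tower of §2 then has NO source and initial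
value `Lc^8 • (wilsonW₂ Tc − wilsonW₂ 0)` (= `Lc^8 • wilsonW₂ Tc` by an3's `wilsonW₂_smul`; `T2Of_dataDiff_zero ∕ _succ`); `λ_r(Tc) := lim β⁰(r,c⃗;cB,Tc) − lim β⁰(r,c⃗;cB,0)` is the constructed limit of its pure-tadpole second moments. -/
theorem tableResponse_eq_lim_tower (hLc : 2 ≤ Lc) (hr : r ∈ box (3 + 1) Lc) (cE cVH cΛ cB : ℝ) (Tc : Fin 4 → Fin 4 → Fin 4 → Fin 4 → ℝ) (μ ν : Fin 4) :
    CauchyRate.lim (fun j => B12Beta.secondMoment (TbalOf Lc (JsBalAn1 (one_le_of_two_le hLc) hr cE cVH cΛ ((Lc : ℝ) ^ (2 * (3 + 1))) cB Tc) j) μ ν) -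
        CauchyRate.lim (fun j => B12Beta.secondMoment (TbalOf Lc (JsBalAn1 (one_le_of_two_le hLc) hr cE cVH cΛ ((Lc : ℝ) ^ (2 * (3 + 1))) cB 0) j) μ ν) =
      CauchyRate.lim (fun j => B12Beta.secondMoment (fun μ ν z => (1 / 2) * tadpole (axDressK Lc (KInvStep (d := 3) Lc j)) (vsym (KInvStep (d := 3) Lc j) Lc
        (T2Of 3 Lc cE cVH cΛ ((Lc : ℝ) ^ (2 * (3 + 1))) cB Tc (vh₂SAt (toSite r) Lc) (mixFFAt (toSite r) Lc) j -
          T2Of 3 Lc cE cVH cΛ ((Lc : ℝ) ^ (2 * (3 + 1))) cB 0 (vh₂SAt (toSite r) Lc) (mixFFAt (toSite r) Lc) j) μ 0 ν z)) μ ν) :=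
  lim_dataDiff_eq hLc hr cE cVH cΛ cB cB Tc 0 μ ν

/-- [folklore] **THE LIMIT IS AFFINE IN THE BORDER WEIGHT, HYPOTHESIS-FREE, FROM BUILT IMPORTS**: `lim β⁰(r,c⃗;cB,Tc) − lim β⁰(r,c⃗;0,Tc) = cB · (lim β⁰(r,c⃗;1,Tc) − lim β⁰(r,c⃗;0,Tc))`
— the border tower is `cB •` the unit border tower (`T2Of_border_affine` at an1's tables), `vsym_smul`, `tadpole_smul`, `secondMoment_smul`, `tendsto_dataDiff` ×2, `tendsto_nhds_unique`; GEN 9's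
`D1PinnedBorderWeightAffine` headline re-derived without that module (so the four-piece normal form of GEN 10's capstone has every ingredient on built imports). -/
theorem lim_border_affine (hLc : 2 ≤ Lc) (hr : r ∈ box (3 + 1) Lc) (cE cVH cΛ cB : ℝ) (Tc : Fin 4 → Fin 4 → Fin 4 → Fin 4 → ℝ) (μ ν : Fin 4) :
    CauchyRate.lim (fun j => B12Beta.secondMoment (TbalOf Lc (JsBalAn1 (one_le_of_two_le hLc) hr cE cVH cΛ ((Lc : ℝ) ^ (2 * (3 + 1))) cB Tc) j) μ ν) -
        CauchyRate.lim (fun j => B12Beta.secondMoment (TbalOf Lc (JsBalAn1 (one_le_of_two_le hLc) hr cE cVH cΛ ((Lc : ℝ) ^ (2 * (3 + 1))) 0 Tc) j) μ ν) =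
      cB * (CauchyRate.lim (fun j => B12Beta.secondMoment (TbalOf Lc (JsBalAn1 (one_le_of_two_le hLc) hr cE cVH cΛ ((Lc : ℝ) ^ (2 * (3 + 1))) 1 Tc) j) μ ν) -
        CauchyRate.lim (fun j => B12Beta.secondMoment (TbalOf Lc (JsBalAn1 (one_le_of_two_le hLc) hr cE cVH cΛ ((Lc : ℝ) ^ (2 * (3 + 1))) 0 Tc) j) μ ν)) := by
  have hT := T2Of_border_affine (d := 3) (Lc := Lc) cE cVH cΛ ((Lc : ℝ) ^ (2 * (3 + 1))) cB Tc (one_le_of_two_le hLc) (hB_an1 (one_le_of_two_le hLc) hr) (hmix_an1 (one_le_of_two_le hLc) hr)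
  have hseq : ∀ j, B12Beta.secondMoment (fun μ ν z => (1 / 2) * tadpole (axDressK Lc (KInvStep (d := 3) Lc j)) (vsym (KInvStep (d := 3) Lc j) Lc
        (T2Of 3 Lc cE cVH cΛ ((Lc : ℝ) ^ (2 * (3 + 1))) cB Tc (vh₂SAt (toSite r) Lc) (mixFFAt (toSite r) Lc) j -
          T2Of 3 Lc cE cVH cΛ ((Lc : ℝ) ^ (2 * (3 + 1))) 0 Tc (vh₂SAt (toSite r) Lc) (mixFFAt (toSite r) Lc) j) μ 0 ν z)) μ ν =
      cB * B12Beta.secondMoment (fun μ ν z => (1 / 2) * tadpole (axDressK Lc (KInvStep (d := 3) Lc j)) (vsym (KInvStep (d := 3) Lc j) Lc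
        (T2Of 3 Lc cE cVH cΛ ((Lc : ℝ) ^ (2 * (3 + 1))) 1 Tc (vh₂SAt (toSite r) Lc) (mixFFAt (toSite r) Lc) j -
          T2Of 3 Lc cE cVH cΛ ((Lc : ℝ) ^ (2 * (3 + 1))) 0 Tc (vh₂SAt (toSite r) Lc) (mixFFAt (toSite r) Lc) j) μ 0 ν z)) μ ν := by
    intro j
    rw [← secondMoment_smul]
    congr 1
    funext μ' ν' z
    simp only [Pi.smul_apply, smul_eq_mul]
    rw [hT j, vsym_smul, tadpole_smul]
    ring
  have h1 := tendsto_dataDiff hLc hr cE cVH cΛ cB 0 Tc Tc μ ν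
  have h2 := ((tendsto_dataDiff hLc hr cE cVH cΛ 1 0 Tc Tc μ ν).const_mul cB).congr fun j => (hseq j).symm
  exact tendsto_nhds_unique h1 h2

end Consequences

end Summit.QuantumFields.BalabanUV.Gaps.D1PinnedResponseTowers

end
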